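import Summits.AtomisticToContinuum.Crystallization.Theorems.SquareWellLayerCakeGapTwelveToBarlowCombinatorialLayeringTransportVComm2

/-!
# Combinatorial layering (B1a of `GapTwelveToBarlow`): transport port, part `VComm2` (second half)

Crux `SquareWellLayerCake.GapTwelveToBarlow` (stmt-AtomisticToContinuum-15807), line `Sketch`,
stub `stub_combinatorialLayering`, residual `(H_develop)`.  PORT of the tree file
`PalmUnimodularRigidityShellsToBarlowChartTransportVComm2.lean` (crux 9227) to GRADED COMBINATORIAL
charts, following the port rules recorded in `…CombinatorialLayeringTransportSteps1` (bundled
standing hypothesis `hch` on `S : ℕ → Set E3`, abstract bond relation `B`, memberships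
`x ∈ S (n + k)`, transfer as an input).  Statements and proofs are otherwise those of the source,
whose documentation follows.

# Line `develop-the-model-growth-descent` (crux `ShellsToBarlowChart`, stmt-AtomisticToContinuum-9227): commutation of `V⁻¹` with `I` and `J` (part 2/3)

Helper lemmas for `stub_transportSystem` (the geometric half of the line): frames `⟨x, t₁, t₂, U⟩`
read in the integer charts `IsZChart` of a good-shell configuration, their transports and the
coherence of the resulting development `frameAt`.  The only metric inputs are the chart transfer
lemma and `bond_nb_iff`; everything else is label combinatorics in `ℤ³` (pattern facts
`TransportPatterns*`).  All `[folklore]` (HalesDSP2012 §1.3 for the two kissing patterns).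
-/

noncomputable section

namespace Summit.AtomisticToContinuum.Crystallization.Theorems.SquareWellLayerCakeGapTwelveToBarlow

open Literature.Geometry.DiscreteGeometry Literature.MathematicalPhysics.StatisticalMechanics
open Summit.AtomisticToContinuum.Crystallization.Theorems.PalmUnimodularRigidityShellsToBarlowChart hiding
  IsZChart TransportSystem scales_tied sqNormInt_transfer bond_symm nb_mem zlab_spec zlab_nb
  bond_nb_iff pattern_cases transfer_nb_nb transfer_nb_centre transfer_nb_target
  sqNormInt_zlab_centre hcp_of_mirror_pair Istep_spec Jstep_spec IinvStep_spec JinvStep_spec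
  capWithAny_of_mem_cap IinvStep_Istep Istep_IinvStep JinvStep_Jstep Jstep_JinvStep polar_at_apex
  onesided_at_apex Vstep_spec nb_inj Istep_lower Jstep_lower IinvStep_lower JinvStep_lower
  polar_at_lower_apex onesided_at_lower_apex VinvStep_spec attach_I_even attach_I_odd
  attach_lower_I_pos attach_lower_I_neg attach_J_even attach_J_odd Vstep_Istep_pt Vstep_Istep_back
  Vstep_Istep_side Vstep_Jstep_pt Vstep_Istep_comm Vstep_Jstep_comm attach_lower_J_pos
  attach_lower_J_neg VinvStep_Istep_pt VinvStep_Jstep_pt VinvStep_Istep_back VinvStep_Istep_side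
  VinvStep_Istep_comm VinvStep_Jstep_comm Istep_Jstep_comm

variable {S : ℕ → Set (EuclideanSpace ℝ (Fin 3))}
  {B : EuclideanSpace ℝ (Fin 3) → EuclideanSpace ℝ (Fin 3) → Prop}
  {Pc : EuclideanSpace ℝ (Fin 3) → Finset (Fin 3 → ℤ)}
  {nb : EuclideanSpace ℝ (Fin 3) → (Fin 3 → ℤ) → EuclideanSpace ℝ (Fin 3)}

variable
  (hch : (∀ n : ℕ, ∀ z ∈ S n, (Pc z = fcc3Int ∨ Pc z = hcpInt) ∧
      Set.BijOn (nb z) (↑(Pc z) : Set (Fin 3 → ℤ)) {y | B z y} ∧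
      ∀ t ∈ Pc z, ∀ t' ∈ Pc z, (B (nb z t) (nb z t') ↔ sqNormInt (t - t') = 18)) ∧
    (∀ n : ℕ, ∀ z ∈ S (n + 1), ∀ y, B z y → y ∈ S n) ∧
    (∀ n m : ℕ, ∀ x ∈ S n, ∀ y ∈ S m, B x y →
      ∀ (z z' : EuclideanSpace ℝ (Fin 3)) (t t' u u' : Fin 3 → ℤ),
        (t = 0 ∧ z = x ∨ t ∈ Pc x ∧ z = nb x t) → (t' = 0 ∧ z' = x ∨ t' ∈ Pc x ∧ z' = nb x t') →
        (u = 0 ∧ z = y ∨ u ∈ Pc y ∧ z = nb y u) → (u' = 0 ∧ z' = y ∨ u' ∈ Pc y ∧ z' = nb y u') →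
        sqNormInt (u - u') = sqNormInt (t - t')) ∧
    (∀ x y, B x y → B y x))

include hch

/-- **`V⁻¹ ∘ I`, the second direction.**  With `d₁ = (V⁻¹ (I g)).pt` and `dJ = (V⁻¹ (J g)).pt`,
the label of `dJ` at `d₁` is `(V⁻¹ (I g)).t₂ − (V⁻¹ (I g)).t₁`. [folklore] -/
theorem VinvStep_Istep_side {n : ℕ} {x : (EuclideanSpace ℝ (Fin 3))}
    (hx : x ∈ S (n + 4)) {t₁ t₂ : Fin 3 → ℤ} {U : Finset (Fin 3 → ℤ)} (hU : IsFrame (Pc x) t₁ t₂ U)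
    (hI : IsFrame (Pc (nb x t₁)) (Istep Pc nb ⟨x, t₁, t₂, U⟩).t₁ (Istep Pc nb ⟨x, t₁, t₂, U⟩).t₂
      (Istep Pc nb ⟨x, t₁, t₂, U⟩).U)
    (hJ : IsFrame (Pc (nb x t₂)) (Jstep Pc nb ⟨x, t₁, t₂, U⟩).t₁ (Jstep Pc nb ⟨x, t₁, t₂, U⟩).t₂
      (Jstep Pc nb ⟨x, t₁, t₂, U⟩).U)
    (hIi : IsFrame (Pc (nb x (-t₁))) (IinvStep Pc nb ⟨x, t₁, t₂, U⟩).t₁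
      (IinvStep Pc nb ⟨x, t₁, t₂, U⟩).t₂ (IinvStep Pc nb ⟨x, t₁, t₂, U⟩).U)
    (hJi : IsFrame (Pc (nb x (-t₂))) (JinvStep Pc nb ⟨x, t₁, t₂, U⟩).t₁
      (JinvStep Pc nb ⟨x, t₁, t₂, U⟩).t₂ (JinvStep Pc nb ⟨x, t₁, t₂, U⟩).U)
    (hII : IsFrame (Pc (nb (nb x t₁) (Istep Pc nb ⟨x, t₁, t₂, U⟩).t₁))
      (Istep Pc nb (Istep Pc nb ⟨x, t₁, t₂, U⟩)).t₁ (Istep Pc nb (Istep Pc nb ⟨x, t₁, t₂, U⟩)).t₂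
      (Istep Pc nb (Istep Pc nb ⟨x, t₁, t₂, U⟩)).U)
    (hJI : IsFrame (Pc (nb (nb x t₁) (Istep Pc nb ⟨x, t₁, t₂, U⟩).t₂))
      (Jstep Pc nb (Istep Pc nb ⟨x, t₁, t₂, U⟩)).t₁ (Jstep Pc nb (Istep Pc nb ⟨x, t₁, t₂, U⟩)).t₂
      (Jstep Pc nb (Istep Pc nb ⟨x, t₁, t₂, U⟩)).U)
    (hIiI : IsFrame (Pc (nb (nb x t₁) (-(Istep Pc nb ⟨x, t₁, t₂, U⟩).t₁)))
      (IinvStep Pc nb (Istep Pc nb ⟨x, t₁, t₂, U⟩)).t₁ (IinvStep Pc nb (Istep Pc nb ⟨x, t₁, t₂, U⟩)).t₂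
      (IinvStep Pc nb (Istep Pc nb ⟨x, t₁, t₂, U⟩)).U)
    (hJiI : IsFrame (Pc (nb (nb x t₁) (-(Istep Pc nb ⟨x, t₁, t₂, U⟩).t₂)))
      (JinvStep Pc nb (Istep Pc nb ⟨x, t₁, t₂, U⟩)).t₁ (JinvStep Pc nb (Istep Pc nb ⟨x, t₁, t₂, U⟩)).t₂
      (JinvStep Pc nb (Istep Pc nb ⟨x, t₁, t₂, U⟩)).U)
    (hcomm : Istep Pc nb (Jstep Pc nb ⟨x, t₁, t₂, U⟩) = Jstep Pc nb (Istep Pc nb ⟨x, t₁, t₂, U⟩)) :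
    zlab Pc nb (VinvStep Pc nb (Istep Pc nb ⟨x, t₁, t₂, U⟩)).pt (VinvStep Pc nb (Jstep Pc nb ⟨x, t₁, t₂, U⟩)).pt =
        (VinvStep Pc nb (Istep Pc nb ⟨x, t₁, t₂, U⟩)).t₂ - (VinvStep Pc nb (Istep Pc nb ⟨x, t₁, t₂, U⟩)).t₁ ∧
      (B (VinvStep Pc nb (Istep Pc nb ⟨x, t₁, t₂, U⟩)).pt (VinvStep Pc nb (Jstep Pc nb ⟨x, t₁, t₂, U⟩)).pt) := by
  have hregI := hregI_of_valid (Pc := Pc) (nb := nb) hI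
  have hregJ := hregJ_of_valid (Pc := Pc) (nb := nb) hJ
  obtain ⟨hyS, hbxy, hwP, hwx, hvP, hvnb, -, -, -, hκ, -, hframe, hparI, -⟩ := Istep_spec hch hx hU hregI
  obtain ⟨hyJS, -, -, -, -, -, -, -, -, -, -, hJframe, hparJ, -⟩ := Jstep_spec hch hx hU hregJ
  obtain ⟨hd'L, hdS, hbd, hξP, hξx, hframeVi, -, hbr⟩ := VinvStep_spec hch hx hU hI hJ hIi hJi
  have hPx := pattern_cases hch hx
  have hPy := pattern_cases hch hyS
  obtain ⟨h12, hhex, hUP, -, -⟩ := id hU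
  have ht₁ : t₁ ∈ Pc x := hhex (mem_hexLabels_iff.2 (Or.inl rfl))
  have ht₂ : t₂ ∈ Pc x := hhex (mem_hexLabels_iff.2 (Or.inr (Or.inl rfl)))
  have ht12 : t₁ - t₂ ∈ Pc x :=
    hhex (mem_hexLabels_iff.2 (Or.inr (Or.inr (Or.inr (Or.inr (Or.inr rfl))))))
  set d' := apexOf t₁ t₂ (lowerCap (Pc x) t₁ t₂ U) with hd'_def
  have hd'P : d' ∈ Pc x := (mem_lowerCap_iff.1 hd'L).1
  have hd'hex : d' ∉ hexLabels t₁ t₂ := (mem_lowerCap_iff.1 hd'L).2.1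
  -- frames `I g`, `J g`
  set a' := (Istep Pc nb ⟨x, t₁, t₂, U⟩).t₁ with ha'
  set b' := (Istep Pc nb ⟨x, t₁, t₂, U⟩).t₂ with hb'
  set U' := (Istep Pc nb ⟨x, t₁, t₂, U⟩).U with hU'
  have hIeq : Istep Pc nb ⟨x, t₁, t₂, U⟩ = ⟨nb x t₁, a', b', U'⟩ := rfl
  set aJ := (Jstep Pc nb ⟨x, t₁, t₂, U⟩).t₁ with haJ
  set bJ := (Jstep Pc nb ⟨x, t₁, t₂, U⟩).t₂ with hbJ_def
  set UJ := (Jstep Pc nb ⟨x, t₁, t₂, U⟩).U with hUJ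
  have hJeq : Jstep Pc nb ⟨x, t₁, t₂, U⟩ = ⟨nb x t₂, aJ, bJ, UJ⟩ := rfl
  rw [hIeq] at hII hJI hIiI hJiI hcomm ⊢
  rw [hJeq] at hcomm ⊢
  obtain ⟨hdL'L, hd₁S, hbyd₁, hξ'P, hξ'y, hframeVi', -, hbr'⟩ :=
    VinvStep_spec hch hyS hframe hII hJI hIiI hJiI
  obtain ⟨h12', hhex', hUP', -, -⟩ := id hframe
  have ha'P : a' ∈ Pc (nb x t₁) := hhex' (mem_hexLabels_iff.2 (Or.inl rfl))
  have hb'P : b' ∈ Pc (nb x t₁) := hhex' (mem_hexLabels_iff.2 (Or.inr (Or.inl rfl)))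
  set dL' := apexOf a' b' (lowerCap (Pc (nb x t₁)) a' b' U') with hdL'_def
  have hdL'P : dL' ∈ Pc (nb x t₁) := (mem_lowerCap_iff.1 hdL'L).1
  have hV'pt : (VinvStep Pc nb ⟨nb x t₁, a', b', U'⟩).pt = nb (nb x t₁) dL' := rfl
  rw [hV'pt] at *
  set d₁ := nb (nb x t₁) dL' with hd₁_def
  set τ₁'' := (VinvStep Pc nb ⟨nb x t₁, a', b', U'⟩).t₁ with hτ₁''_def
  set τ₂'' := (VinvStep Pc nb ⟨nb x t₁, a', b', U'⟩).t₂ with hτ₂''_def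
  have hPd₁ := pattern_cases hch hd₁S
  obtain ⟨h12'', hhex'', -, -, -⟩ := id hframeVi'
  have hτ21P : τ₂'' - τ₁'' ∈ Pc d₁ := hhex'' (mem_hexLabels_iff.2 (Or.inr (Or.inr (Or.inl rfl))))
  have Dτ12 : sqNormInt (τ₁'' - τ₂'') = 18 := h12''
  -- the point `dJ = (V⁻¹ (J g)).pt`
  set dJ' := apexOf aJ bJ (lowerCap (Pc (nb x t₂)) aJ bJ UJ) with hdJ'_def
  have hVJpt : (VinvStep Pc nb ⟨nb x t₂, aJ, bJ, UJ⟩).pt = nb (nb x t₂) dJ' := rfl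
  rw [hVJpt]
  rcases hbr with ⟨hlp, -, -, -, -⟩ | ⟨hlp, -, -, -, -⟩
  · /- letter below `+1`: everything is read in the chart of `x` -/
    rcases hbr' with ⟨-, hUd₁, hnI', hnJ', -⟩ | ⟨hlp'', -, -, -, -⟩
    swap
    · obtain ⟨hlp', -, -⟩ := attach_lower_I_pos hch hx hU hlp hregI
      rw [hIeq] at hlp'
      exact absurd (hlp'.symm.trans hlp'') (by norm_num)
    obtain ⟨-, -, -, hd1, hd2, hLeq⟩ := pos_form_of_lowerParity hPx hU hlp
    obtain ⟨-, hattI, -⟩ := attach_lower_I_pos hch hx hU hlp hregI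
    obtain ⟨-, hattJ, -⟩ := attach_lower_J_pos hch hx hU hlp hregJ
    rw [hIeq] at hattI
    rw [hJeq] at hattJ
    have hd₁x : nb x (d' + t₁) = d₁ := hattI.symm
    have hdJx : nb (nb x t₂) dJ' = nb x (d' + t₂) := hattJ
    rw [hdJx]
    have hyx : nb (nb x t₁) (-a') = x := by
      show nb (nb x t₁) (-(-zlab Pc nb (nb x t₁) x)) = x
      rw [neg_neg]; exact hwx
    have hyz : nb (nb x t₁) (-b') = nb x (t₁ - t₂) := by
      have e : -b' = zlab Pc nb (nb x t₁) (nb x (t₁ - t₂)) := by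
        rw [hκ]
        show -(zlab Pc nb (nb x t₁) (nb x t₂) - zlab Pc nb (nb x t₁) x) = _
        abel
      rw [e]
      exact (zlab_spec hch hyS (nb_mem hch hx ht12).1 ((bond_nb_iff hch hx ht₁ ht12).2
        (dist_hexagon (Pc x) hPx t₁ ht₁ t₂ ht₂ h12 hhex).2.2.2.2.2.1)).2
    have hη'P : zlab Pc nb d₁ (nb x t₁) - τ₁'' ∈ Pc d₁ := hframeVi'.2.2.1 (by rw [hUd₁]; simp)
    have hζ'P : zlab Pc nb d₁ (nb x t₁) - τ₂'' ∈ Pc d₁ := hframeVi'.2.2.1 (by rw [hUd₁]; simp)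
    have hη' : zlab Pc nb d₁ x = zlab Pc nb d₁ (nb x t₁) - τ₁'' := by
      have h : zlab Pc nb d₁ (nb (nb x t₁) (-a')) = zlab Pc nb d₁ (nb x t₁) - τ₁'' := by
        rw [← hnI']; exact zlab_nb hch hd₁S hη'P
      rwa [hyx] at h
    have hζ' : zlab Pc nb d₁ (nb x (t₁ - t₂)) = zlab Pc nb d₁ (nb x t₁) - τ₂'' := by
      have h : zlab Pc nb d₁ (nb (nb x t₁) (-b')) = zlab Pc nb d₁ (nb x t₁) - τ₂'' := by
        rw [← hnJ']; exact zlab_nb hch hd₁S hζ'P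
      rwa [hyz] at h
    have hbxd₁ : B x d₁ := by
      rw [← hd₁x]; exact (nb_mem hch hx hd1).2
    have hbd₁dJ : B d₁ (nb x (d' + t₂)) := by
      have := (bond_nb_iff hch hx hd1 hd2).2 (by
        rw [show d' + t₁ - (d' + t₂) = t₁ - t₂ by abel]; exact h12)
      rwa [hd₁x] at this
    have hbd₁z : B d₁ (nb x (t₁ - t₂)) := by
      have h : B d₁ (nb (nb x t₁) (-b')) := by
        rw [← hnJ']; exact (nb_mem hch hd₁S hζ'P).2
      rwa [hyz] at h
    have hdJS : nb x (d' + t₂) ∈ S _ := (nb_mem hch hx hd2).1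
    have hβ := zlab_spec hch hd₁S hdJS hbd₁dJ
    have Dβη : sqNormInt (zlab Pc nb d₁ (nb x (d' + t₂)) - zlab Pc nb d₁ x) = 18 := by
      rw [transfer_nb_centre hch hx hd₁S hbxd₁ hd2 hbd₁dJ]; exact chart_sqNormInt_eq hch hx hd2
    have Dβζ : sqNormInt (zlab Pc nb d₁ (nb x (d' + t₂)) - zlab Pc nb d₁ (nb x (t₁ - t₂))) = 54 := by
      rw [transfer_nb_nb hch hx hd₁S hbxd₁ hd2 ht12 hbd₁dJ hbd₁z]
      exact (dist_oddCap_cb (Pc x) hPx t₁ ht₁ t₂ ht₂ d' hd'P h12 hhex hd'hex hd1 hd2).2.2.2.2.2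
    have hβeq : zlab Pc nb d₁ (nb x (d' + t₂)) = τ₂'' - τ₁'' := by
      have h := label_third_vertex (Pc d₁) hPd₁ (zlab Pc nb d₁ (nb x t₁) - τ₂'') hζ'P
        (zlab Pc nb d₁ (nb x t₁) - τ₁'') hη'P _ hβ.1
        (by rw [show zlab Pc nb d₁ (nb x t₁) - τ₂'' - (zlab Pc nb d₁ (nb x t₁) - τ₁'') = τ₁'' - τ₂'' by abel]
            exact Dτ12)
        (by rw [← hη']; exact Dβη) (by rw [← hζ']; exact Dβζ)
        (by rw [show zlab Pc nb d₁ (nb x t₁) - τ₁'' - (zlab Pc nb d₁ (nb x t₁) - τ₂'') = τ₂'' - τ₁'' by abel]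
            exact hτ21P)
      rw [h]; abel
    exact ⟨hβeq, hbd₁dJ⟩
  · /- letter below `−1`: everything is read in the chart of `x'' = JIx = nb y b'` -/
    obtain ⟨hlp', hattJI, hlabJI⟩ := attach_lower_I_neg hch hx hU hlp hregI
    rw [hIeq] at hlp' hattJI hlabJI
    rcases hbr' with ⟨hlp'', -, -, -, -⟩ | ⟨-, hUd₁, hnI', hnJ', -⟩
    · rw [hlp'] at hlp''; norm_num at hlp''
    -- the frame `J (I g) = ⟨x'', a'', b'', U''⟩` and its lower cap
    set a'' := (Jstep Pc nb ⟨nb x t₁, a', b', U'⟩).t₁ with ha''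
    set b'' := (Jstep Pc nb ⟨nb x t₁, a', b', U'⟩).t₂ with hb''
    set U'' := (Jstep Pc nb ⟨nb x t₁, a', b', U'⟩).U with hU''
    have hJIeq : Jstep Pc nb ⟨nb x t₁, a', b', U'⟩ = ⟨nb (nb x t₁) b', a'', b'', U''⟩ := rfl
    have hregJI := hregJ_of_valid (Pc := Pc) (nb := nb) hJI
    obtain ⟨hx''S, hbyx'', hw''P, hw''y, hv''P, hv''nb, -, -, -, -, -, hframe'', -, -⟩ :=
      Jstep_spec hch hyS hframe hregJI
    have hPx'' := pattern_cases hch hx''S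
    obtain ⟨h12x, hhexx, -, -, -⟩ := id hframe''
    have ha''P : a'' ∈ Pc (nb (nb x t₁) b') := hhexx (mem_hexLabels_iff.2 (Or.inl rfl))
    have hb''P : b'' ∈ Pc (nb (nb x t₁) b') := hhexx (mem_hexLabels_iff.2 (Or.inr (Or.inl rfl)))
    have hab''P : a'' - b'' ∈ Pc (nb (nb x t₁) b') :=
      hhexx (mem_hexLabels_iff.2 (Or.inr (Or.inr (Or.inr (Or.inr (Or.inr rfl))))))
    -- `d₁ = nb x'' (dL'' − b'')` by the lower J-attachment at `I g`
    obtain ⟨hlpJI, hattJ, -⟩ := attach_lower_J_neg hch hyS hframe hlp' hregJI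
    rw [hJIeq] at hlpJI hattJ
    obtain ⟨hdL''L, hdL''P, hdL''hex, hd1'', hd2'', hL''eq⟩ := neg_form_of_lowerParity hPx'' hframe'' hlpJI
    set dL'' := apexOf a'' b'' (lowerCap (Pc (nb (nb x t₁) b')) a'' b'' U'') with hdL''_def
    have hd₁x'' : nb (nb (nb x t₁) b') (dL'' - b'') = d₁ := hattJ
    -- `dJ = nb x'' (dL'' − a'')` by the lower I-attachment at `J g` through the in-layer commutation
    obtain ⟨hlpJ, -, -⟩ := attach_lower_J_neg hch hx hU hlp hregJ
    rw [hJeq] at hlpJ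
    have hpteq : nb (nb x t₂) aJ = nb (nb x t₁) b' := congrArg ZFrame.pt hcomm
    have hregIJ : Pc (nb (nb x t₂) aJ) = fcc3Int ∨ Pc (nb x t₂) = hcpInt ∨
        (-zlab Pc nb (nb (nb x t₂) aJ) (nb x t₂) ∈ Pc (nb (nb x t₂) aJ) ∧
          -zlab Pc nb (nb (nb x t₂) aJ) (nb (nb x t₂) bJ) ∈ Pc (nb (nb x t₂) aJ)) := by
      apply hregI_of_valid (Pc := Pc) (nb := nb)
      rw [hcomm, hpteq]; exact hJI
    obtain ⟨-, hattI, -⟩ := attach_lower_I_neg hch hyJS hJframe hlpJ hregIJ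
    rw [hcomm] at hattI
    rw [hpteq] at hattI
    have hdJx'' : nb (nb (nb x t₁) b') (dL'' - a'') = nb (nb x t₂) dJ' := hattI
    -- bonds at `x''`
    have hbd₁dJ : B d₁ (nb (nb x t₂) dJ') := by
      have := (bond_nb_iff hch hx''S hd2'' hd1'').2 (by
        rw [show dL'' - b'' - (dL'' - a'') = a'' - b'' by abel]; exact h12x)
      rwa [hd₁x'', hdJx''] at this
    have hbx''d₁ : B (nb (nb x t₁) b') d₁ := by
      rw [← hd₁x'']; exact (nb_mem hch hx''S hd2'').2
    have hdJS : nb (nb x t₂) dJ' ∈ S (n + 1) := by rw [← hdJx'']; exact (nb_mem hch hx''S hd1'').1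
    have hβ := zlab_spec hch hd₁S hdJS hbd₁dJ
    -- `ζ' = ξ' + τ₂''` labels `x''`, `η' = ξ' + τ₁''` labels `IIx = nb x'' (a'' − b'')`
    have hζ'P : zlab Pc nb d₁ (nb x t₁) + τ₂'' ∈ Pc d₁ := hframeVi'.2.2.1 (by rw [hUd₁]; simp)
    have hη'P : zlab Pc nb d₁ (nb x t₁) + τ₁'' ∈ Pc d₁ := hframeVi'.2.2.1 (by rw [hUd₁]; simp)
    have hζ' : zlab Pc nb d₁ (nb (nb x t₁) b') = zlab Pc nb d₁ (nb x t₁) + τ₂'' := by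
      rw [← hnJ']; exact zlab_nb hch hd₁S hζ'P
    have hη' : zlab Pc nb d₁ (nb (nb x t₁) a') = zlab Pc nb d₁ (nb x t₁) + τ₁'' := by
      rw [← hnI']; exact zlab_nb hch hd₁S hη'P
    have hbd₁II : B d₁ (nb (nb x t₁) a') := by
      rw [← hnI']; exact (nb_mem hch hd₁S hη'P).2
    have hIIx'' : nb (nb (nb x t₁) b') (a'' - b'') = nb (nb x t₁) a' := by
      have e : a'' - b'' = zlab Pc nb (nb (nb x t₁) b') (nb (nb x t₁) a') := by
        show (zlab Pc nb (nb (nb x t₁) b') (nb (nb x t₁) a') - zlab Pc nb (nb (nb x t₁) b') (nb x t₁)) -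
          -zlab Pc nb (nb (nb x t₁) b') (nb x t₁) = _
        abel
      rw [e]; exact hv''nb
    have Dβζ : sqNormInt (zlab Pc nb d₁ (nb (nb x t₂) dJ') - zlab Pc nb d₁ (nb (nb x t₁) b')) = 18 := by
      have h := transfer_nb_centre hch hx''S hd₁S hbx''d₁ hd1'' (by rw [hdJx'']; exact hbd₁dJ)
      rw [hdJx''] at h
      rw [h]; exact chart_sqNormInt_eq hch hx''S hd1''
    have Dβη : sqNormInt (zlab Pc nb d₁ (nb (nb x t₂) dJ') - zlab Pc nb d₁ (nb (nb x t₁) a')) = 54 := by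
      have h := transfer_nb_nb hch hx''S hd₁S hbx''d₁ hd1'' hab''P (by rw [hdJx'']; exact hbd₁dJ)
        (by rw [hIIx'']; exact hbd₁II)
      rw [hdJx'', hIIx''] at h
      rw [h]
      exact (dist_evenCap_ca (Pc (nb (nb x t₁) b')) hPx'' a'' ha''P b'' hb''P dL'' hdL''P h12x hhexx
        hdL''hex hd1'' hd2'').2.2.2.2.2
    have hβeq : zlab Pc nb d₁ (nb (nb x t₂) dJ') = τ₂'' - τ₁'' := by
      have h := label_third_vertex (Pc d₁) hPd₁ (zlab Pc nb d₁ (nb x t₁) + τ₁'') hη'P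
        (zlab Pc nb d₁ (nb x t₁) + τ₂'') hζ'P _ hβ.1
        (by rw [show zlab Pc nb d₁ (nb x t₁) + τ₁'' - (zlab Pc nb d₁ (nb x t₁) + τ₂'') = τ₁'' - τ₂'' by abel]
            exact Dτ12)
        (by rw [← hζ']; exact Dβζ) (by rw [← hη']; exact Dβη)
        (by rw [show zlab Pc nb d₁ (nb x t₁) + τ₂'' - (zlab Pc nb d₁ (nb x t₁) + τ₁'') = τ₂'' - τ₁'' by abel]
            exact hτ21P)
      rw [h]; abel
    exact ⟨hβeq, hbd₁dJ⟩

omit hch in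

/-! ## Registered anchor (closed form) -/

omit hch in
/-- **Closed form of `VinvStep_Istep_side`** (the registered anchor of this file): the section data
`S, B, Pc, nb` and the standing hypothesis written out, the frame packaged as a `ZFrame`
and the validity hypotheses of the transported frames as one quantified clause. [folklore] -/
theorem VinvStep_Istep_side_graded :
    ∀ {S : ℕ → Set (EuclideanSpace ℝ (Fin 3))} {B : EuclideanSpace ℝ (Fin 3) → EuclideanSpace ℝ
    (Fin 3) → Prop} {Pc : EuclideanSpace ℝ (Fin 3) → Finset (Fin 3 → ℤ)} {nb : EuclideanSpace ℝ
    (Fin 3) → (Fin 3 → ℤ) → EuclideanSpace ℝ (Fin 3)}, ((∀ n : ℕ, ∀ z ∈ S n, (Pc z =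
    Summit.AtomisticToContinuum.Crystallization.Theorems.PalmUnimodularRigidityShellsToBarlowChart.fcc3Int
    ∨ Pc z = Literature.Geometry.DiscreteGeometry.hcpInt) ∧ Set.BijOn (nb z) (↑(Pc z) : Set (Fin
    3 → ℤ)) {y | B z y} ∧ ∀ t ∈ Pc z, ∀ t' ∈ Pc z, (B (nb z t) (nb z t') ↔
    Literature.Geometry.DiscreteGeometry.sqNormInt (t - t') = 18)) ∧ (∀ n : ℕ, ∀ z ∈ S (n + 1),
    ∀ y, B z y → y ∈ S n) ∧ (∀ n m : ℕ, ∀ x ∈ S n, ∀ y ∈ S m, B x y → ∀ (z z' : EuclideanSpace ℝ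
    (Fin 3)) (t t' u u' : Fin 3 → ℤ), (t = 0 ∧ z = x ∨ t ∈ Pc x ∧ z = nb x t) → (t' = 0 ∧ z' = x
    ∨ t' ∈ Pc x ∧ z' = nb x t') → (u = 0 ∧ z = y ∨ u ∈ Pc y ∧ z = nb y u) → (u' = 0 ∧ z' = y ∨
    u' ∈ Pc y ∧ z' = nb y u') → Literature.Geometry.DiscreteGeometry.sqNormInt (u - u') =
    Literature.Geometry.DiscreteGeometry.sqNormInt (t - t')) ∧ (∀ x y, B x y → B y x)) → ∀ (n :
    ℕ) (f :
    Summit.AtomisticToContinuum.Crystallization.Theorems.PalmUnimodularRigidityShellsToBarlowChart.ZFrame),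
    f.pt ∈ S (n + 4) → (∀ g :
    Summit.AtomisticToContinuum.Crystallization.Theorems.PalmUnimodularRigidityShellsToBarlowChart.ZFrame,
    g = f ∨ g =
    Summit.AtomisticToContinuum.Crystallization.Theorems.PalmUnimodularRigidityShellsToBarlowChart.Istep
    Pc nb f ∨ g =
    Summit.AtomisticToContinuum.Crystallization.Theorems.PalmUnimodularRigidityShellsToBarlowChart.Jstep
    Pc nb f ∨ g =
    Summit.AtomisticToContinuum.Crystallization.Theorems.PalmUnimodularRigidityShellsToBarlowChart.IinvStep
    Pc nb f ∨ g =
    Summit.AtomisticToContinuum.Crystallization.Theorems.PalmUnimodularRigidityShellsToBarlowChart.JinvStep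
    Pc nb f ∨ g =
    Summit.AtomisticToContinuum.Crystallization.Theorems.PalmUnimodularRigidityShellsToBarlowChart.Istep
    Pc nb
    (Summit.AtomisticToContinuum.Crystallization.Theorems.PalmUnimodularRigidityShellsToBarlowChart.Istep
    Pc nb f) ∨ g =
    Summit.AtomisticToContinuum.Crystallization.Theorems.PalmUnimodularRigidityShellsToBarlowChart.Jstep
    Pc nb
    (Summit.AtomisticToContinuum.Crystallization.Theorems.PalmUnimodularRigidityShellsToBarlowChart.Istep
    Pc nb f) ∨ g =
    Summit.AtomisticToContinuum.Crystallization.Theorems.PalmUnimodularRigidityShellsToBarlowChart.IinvStep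
    Pc nb
    (Summit.AtomisticToContinuum.Crystallization.Theorems.PalmUnimodularRigidityShellsToBarlowChart.Istep
    Pc nb f) ∨ g =
    Summit.AtomisticToContinuum.Crystallization.Theorems.PalmUnimodularRigidityShellsToBarlowChart.JinvStep
    Pc nb
    (Summit.AtomisticToContinuum.Crystallization.Theorems.PalmUnimodularRigidityShellsToBarlowChart.Istep
    Pc nb f) →
    Summit.AtomisticToContinuum.Crystallization.Theorems.PalmUnimodularRigidityShellsToBarlowChart.IsFrame
    (Pc g.pt) g.t₁ g.t₂ g.U) →
    Summit.AtomisticToContinuum.Crystallization.Theorems.PalmUnimodularRigidityShellsToBarlowChart.Istep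
    Pc nb
    (Summit.AtomisticToContinuum.Crystallization.Theorems.PalmUnimodularRigidityShellsToBarlowChart.Jstep
    Pc nb f) =
    Summit.AtomisticToContinuum.Crystallization.Theorems.PalmUnimodularRigidityShellsToBarlowChart.Jstep
    Pc nb
    (Summit.AtomisticToContinuum.Crystallization.Theorems.PalmUnimodularRigidityShellsToBarlowChart.Istep
    Pc nb f) → (B
    (Summit.AtomisticToContinuum.Crystallization.Theorems.PalmUnimodularRigidityShellsToBarlowChart.VinvStep
    Pc nb
    (Summit.AtomisticToContinuum.Crystallization.Theorems.PalmUnimodularRigidityShellsToBarlowChart.Istep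
    Pc nb f)).pt
    (Summit.AtomisticToContinuum.Crystallization.Theorems.PalmUnimodularRigidityShellsToBarlowChart.VinvStep
    Pc nb
    (Summit.AtomisticToContinuum.Crystallization.Theorems.PalmUnimodularRigidityShellsToBarlowChart.Jstep
    Pc nb f)).pt) := by
  intro S B Pc nb hch n f hx hval hcomm
  obtain ⟨x, t₁, t₂, U⟩ := f
  exact (VinvStep_Istep_side hch hx (hval _ (Or.inl rfl)) (hval _ (Or.inr (Or.inl rfl))) (hval _ (Or.inr (Or.inr (Or.inl rfl)))) (hval _ (Or.inr (Or.inr (Or.inr (Or.inl rfl))))) (hval _ (Or.inr (Or.inr (Or.inr (Or.inr (Or.inl rfl)))))) (hval _ (Or.inr (Or.inr (Or.inr (Or.inr (Or.inr (Or.inl rfl))))))) (hval _ (Or.inr (Or.inr (Or.inr (Or.inr (Or.inr (Or.inr (Or.inl rfl)))))))) (hval _ (Or.inr (Or.inr (Or.inr (Or.inr (Or.inr (Or.inr (Or.inr (Or.inl rfl))))))))) (hval _ (Or.inr (Or.inr (Or.inr (Or.inr (Or.inr (Or.inr (Or.inr (Or.inr (rfl)))))))))) hcomm).2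

end Summit.AtomisticToContinuum.Crystallization.Theorems.SquareWellLayerCakeGapTwelveToBarlow

end
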